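import Summits.RiemannHypothesis.RiemannHypothesis.Theorems.PfPersistenceM2TranslationDefect
import HarnessLib

/-!
# Pf-persistence index route (M2): an EFFECTIVE first even threshold in the lone-quadruple world

pub-rhpf cell (M2 seat, generation 9).  HONEST FRAMING: long-odds MECHANISM SEARCH; no RH claims.
Every result in this file is RH-free and kernel-checked; none asserts or refutes RH.  Labels: PROVED.

Notation as in `PfPersistenceM2TranslationDefect` (`Q`, `k̂`, `P_k`, `m`, `g_T = 𝔰⟪k, T⟫ =
(k(·-T) + k(·+T))/2`, `F(ρ,T) = 𝔉⟪ρ, T⟫ = cosh²((ρ-½)T)`, local notations) and the `PfPersistenceM2*` index files: `EvenNegIndexAtLeast n a` = the window `[-a, a]`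
carries `n` even real compactly supported Weil tests spanning a `Re Q`-negative-definite family;
`a₁^{ev} = sInf {a : EvenNegIndexAtLeast 1 a}` is the first even threshold (`> (log 2)/2`, not
attained: `PfPersistenceM2ShortWindows`, `PfPersistenceM2ThresholdOpen`);
`𝒬 = {ρ : ζ(ρ) = 0 non-trivial, Re ρ > ½, Im ρ > 0}`, `K = #𝒬`.  The tree knew
`a₁^{ev} < ∞ ⟺ K ≥ 1` (`evenNegIndexAtLeast_succ_iff`), but every bound on it was INEFFECTIVE
(Landau engine / identity theorem / `∃ᶠ a → ∞`).  Here: an EXPLICIT window, in the `K = 1` world.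

PROVED here (lone-quadruple world: every off-line zero lies in `{e, ē, 1-e, 1-ē}`, `Re e > ½`):
* `evenNegIndexAtLeast_one_of_neg` — one even real test with `Re Q < 0` in `[-a,a]` gives level `1`.
* (T5) `evenNegIndexAtLeast_one_of_lone` — `k` even real in `[-a,a]`, `T ≥ 0` TUNED
  (`P_k(e) e^{2iγT} = -|P_k(e)|`) with `Re Q(k) < 2 m(e)|P_k(e)|(sinh(2δT) - 1)` ⟹
  `EvenNegIndexAtLeast 1 (a + T)`.
* (T5') `sInf_evenNegIndexAtLeast_one_le_of_lone`, `…_of_quadrant_eq_singleton` — THE EFFECTIVE BOUND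
  `a₁^{ev} ≤ a + max(0, arsinh(1 + Re Q(k)/(2 m(e)|k̂(e)|²)) / (2δ)) + π/γ`
  for every even real Weil test `k` in `[-a,a]` with `k̂(e) ≠ 0` (`δ = Re e - ½`, `γ = Im e`).
* (T6) `lone_zero_invisible_of_not_evenNegIndexAtLeast` — RIGIDITY READING: if `[-A, A]` carries no
  even negative direction, then `2 m(e)|k̂(e)|² (sinh(2δ(A - a - π/γ)) - 1) ≤ Re Q(k)` for every even
  real `k` in `[-a,a]` (`a + π/γ ≤ A`): persistence of even positivity up to `A` makes the lone zero
  exponentially INVISIBLE (`|k̂(e)|² ≲ Re Q(k) e^{-2δA}`) to every shorter test.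
* (T7) `re_expSum_le_of_lone` — EFFECTIVE LANDAU `Ω₋` for the zero sum `B_k(y) = Σ m P_k(ρ)e^{(ρ-½)y}`:
  `Re B_k(2T) ≤ Re Q(k) - 4 m(e)|P_k(e)|(sinh(2δT) - 1)` at every tuned `T`.
* `lone_of_quadrant_eq_singleton` — `𝒬 = {e}` (`K = 1`) is the lone-quadruple world.

WHY `K = 1`: it is exactly the configuration the cell's second-level invariants cannot see
(`forall_secondRayleigh_nonneg_iff_encard_le_one`, `evenBlind_realSees_of_card_eq_one`); the first
level sees it, and this file says HOW FAST in the window variable.  The ε₁-floor / RH-strength input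
is untouched: nothing here bounds `a₁^{ev}` from below beyond `(log 2)/2`, and under RH the hypotheses
are vacuous (`K = 0`).  HONEST GRADE: VARIANT (effective Landau–Littlewood in Weil form)
[cite: MontgomeryVaughan2007, Thm. 15.8]
[cite: Bombieri2000Weil, §5].  mechanism/rigidity campaign; no RH claims.
-/

noncomputable section

set_option linter.dupNamespace false

open Complex Filter Set MeasureTheory
open scoped Real Topology ComplexConjugate BigOperators

namespace Summit.RiemannHypothesis.RiemannHypothesis.Theorems.PfPersistenceM2NegIndex

open Literature.NumberTheory.LFunctions
open Literature.NumberTheory.LFunctions.WeilConverse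
open Literature.NumberTheory.LFunctions.ZetaZeros
open Summit.RiemannHypothesis.RiemannHypothesis.Theorems.RuelleBandExactFirstBand

/-- `𝔰⟪k, T⟫ = g_T`, the symmetric translate `t ↦ (k(t - T) + k(t + T)) / 2`. -/
local notation "𝔰⟪" k ", " T "⟫" => fun t : ℝ => (k (t - T) + k (t + T)) / 2

/-- `𝔉⟪ρ, T⟫ = F(ρ,T) = (e^{(ρ-½)2T} + e^{(½-ρ)2T} + 2)/4 = cosh²((ρ-½)T)`, the zero-side weight of
`g_T`: `P_{g_T}(ρ) = P_k(ρ) F(ρ,T)` (`pairCoeff_symTranslate`). -/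
local notation "𝔉⟪" ρ ", " T "⟫" =>
  (cexp ((ρ - 1 / 2) * ((2 * T : ℝ) : ℂ)) + cexp ((1 / 2 - ρ) * ((2 * T : ℝ) : ℂ)) + 2) / 4

/-! ## (T5) The effective first even threshold -/

/-- One even real Weil test in `[-a, a]` with `Re Q < 0` gives `EvenNegIndexAtLeast 1 a`. -/
theorem evenNegIndexAtLeast_one_of_neg {g : ℝ → ℂ} (hg : IsWeilTest g)
    (hev : ∀ t : ℝ, g (-t) = g t) (hre : ∀ t : ℝ, (g t).im = 0) {a : ℝ}
    (hsupp : tsupport g ⊆ Icc (-a) a) (hneg : (weilQuadratic g).re < 0) :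
    EvenNegIndexAtLeast 1 a := by
  refine ⟨fun _ ↦ g, fun _ ↦ hg, fun _ ↦ hev, fun _ ↦ hre, fun _ ↦ hsupp, fun c hc ↦ ?_⟩
  have hc0 : c 0 ≠ 0 := by
    intro h
    apply hc
    funext i
    rw [Subsingleton.elim i 0, h]
    rfl
  have hsum : (fun t : ℝ ↦ ∑ i : Fin 1, (c i : ℂ) * g t) = fun t ↦ (c 0 : ℂ) * g t := by
    funext t
    simp
  rw [hsum, weilQuadratic_const_mul, Complex.normSq_ofReal, Complex.re_ofReal_mul]
  exact mul_neg_of_pos_of_neg (mul_self_pos.2 hc0) hneg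

/-- **(T5) Effective threshold, lone-quadruple world.** `k` an even real Weil test in `[-a, a]`,
`e` the lone off-line zero (`Re e > 1/2`), `T ≥ 0` a TUNED translation length
(`P_k(e) e^{2iγT} = -|P_k(e)|`, such `T` exist in every window of length `π/γ`, `exists_tuned`)
with `Re Q(k) < 2 m(e) |P_k(e)| (sinh(2δT) - 1)`. Then the window `[-(a+T), a+T]` carries an even
negative direction: `EvenNegIndexAtLeast 1 (a + T)`. (`|P_k(e)| = |k̂(e)|²`, `norm_pairCoeff_of_even_real`.) -/
theorem evenNegIndexAtLeast_one_of_lone {k : ℝ → ℂ} (hk : IsWeilTest k)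
    (hev : ∀ t : ℝ, k (-t) = k t) (hre : ∀ t : ℝ, (k t).im = 0) {a : ℝ}
    (hsupp : tsupport k ⊆ Icc (-a) a) {e : ℂ} (he : e ∈ riemannZetaNontrivialZeros)
    (hδ : 1 / 2 < e.re)
    (hlone : ∀ ρ ∈ riemannZetaNontrivialZeros,
      ρ.re ≠ 1 / 2 → ρ = e ∨ ρ = conj e ∨ ρ = 1 - e ∨ ρ = 1 - conj e)
    {T : ℝ} (hT : 0 ≤ T)
    (htune : pairCoeff k e * cexp (((e.im * (2 * T) : ℝ) : ℂ) * I) = -(‖pairCoeff k e‖ : ℂ))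
    (hbig : (weilQuadratic k).re <
      2 * riemannZetaZeroOrder e * ‖pairCoeff k e‖ * (Real.sinh (2 * (e.re - 1 / 2) * T) - 1)) :
    EvenNegIndexAtLeast 1 (a + T) := by
  have h3 := re_weilQuadratic_symShift_le_of_lone hk hev hre he hδ hlone T
  have h4 := re_mul_coshSq_sub_one_le htune
  have hm : (0 : ℝ) ≤ riemannZetaZeroOrder e := by
    have : (1 : ℝ) ≤ riemannZetaZeroOrder e := by
      exact_mod_cast riemannZetaNontrivialZeros.one_le_order he
    linarith
  refine evenNegIndexAtLeast_one_of_neg (isWeilTest_symTranslate hk T) (symTranslate_even hev T)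
    (symTranslate_im hre T) (tsupport_symTranslate_subset hsupp hT) ?_
  nlinarith [mul_le_mul_of_nonneg_left h4 hm]

/-- **(T5') The effective bound on the first even threshold (lone-quadruple world).**
With `T₀ = max (0, arsinh(1 + Re Q(k) / (2 m(e) |P_k(e)|)) / (2δ))`:
`a₁^{ev} = inf {a' : EvenNegIndexAtLeast 1 a'} ≤ a + T₀ + π/γ`. -/
theorem sInf_evenNegIndexAtLeast_one_le_of_lone {k : ℝ → ℂ} (hk : IsWeilTest k)
    (hev : ∀ t : ℝ, k (-t) = k t) (hre : ∀ t : ℝ, (k t).im = 0) {a : ℝ}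
    (hsupp : tsupport k ⊆ Icc (-a) a) {e : ℂ} (he : e ∈ riemannZetaNontrivialZeros)
    (hδ : 1 / 2 < e.re) (hγ : 0 < e.im)
    (hlone : ∀ ρ ∈ riemannZetaNontrivialZeros,
      ρ.re ≠ 1 / 2 → ρ = e ∨ ρ = conj e ∨ ρ = 1 - e ∨ ρ = 1 - conj e)
    (hP : pairCoeff k e ≠ 0) :
    sInf {a' : ℝ | EvenNegIndexAtLeast 1 a'} ≤
      a + max 0 (Real.arsinh (1 + (weilQuadratic k).re /
        (2 * riemannZetaZeroOrder e * ‖pairCoeff k e‖)) / (2 * (e.re - 1 / 2))) + π / e.im := by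
  set R : ℝ := Real.arsinh (1 + (weilQuadratic k).re /
    (2 * riemannZetaZeroOrder e * ‖pairCoeff k e‖)) / (2 * (e.re - 1 / 2)) with hR
  refine le_of_forall_pos_le_add fun ε hε ↦ ?_
  obtain ⟨T, ⟨hT1, hT2⟩, htune⟩ := exists_tuned (pairCoeff k e) hγ (max 0 R + ε)
  have hT0 : 0 ≤ T := by linarith [le_max_left 0 R]
  have hmpos : (0 : ℝ) < riemannZetaZeroOrder e := by
    have : (1 : ℝ) ≤ riemannZetaZeroOrder e := by
      exact_mod_cast riemannZetaNontrivialZeros.one_le_order he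
    linarith
  have hPpos : 0 < ‖pairCoeff k e‖ := norm_pos_iff.2 hP
  have hc : 0 < 2 * (riemannZetaZeroOrder e : ℝ) * ‖pairCoeff k e‖ := by positivity
  have hδ2 : 0 < 2 * (e.re - 1 / 2) := by linarith
  have hbig : (weilQuadratic k).re <
      2 * riemannZetaZeroOrder e * ‖pairCoeff k e‖ * (Real.sinh (2 * (e.re - 1 / 2) * T) - 1) := by
    have h1 : Real.arsinh (1 + (weilQuadratic k).re /
        (2 * riemannZetaZeroOrder e * ‖pairCoeff k e‖)) < 2 * (e.re - 1 / 2) * T := by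
      have hRT : R < T := by linarith [le_max_right 0 R]
      rw [hR, div_lt_iff₀ hδ2] at hRT
      linarith
    have h2 := Real.sinh_lt_sinh.2 h1
    rw [Real.sinh_arsinh] at h2
    have h4 : 2 * (riemannZetaZeroOrder e : ℝ) * ‖pairCoeff k e‖ *
        (1 + (weilQuadratic k).re / (2 * riemannZetaZeroOrder e * ‖pairCoeff k e‖)) =
        2 * riemannZetaZeroOrder e * ‖pairCoeff k e‖ + (weilQuadratic k).re := by
      field_simp
    have h5 := mul_lt_mul_of_pos_left h2 hc
    rw [h4] at h5
    linarith
  have hidx := evenNegIndexAtLeast_one_of_lone hk hev hre hsupp he hδ hlone hT0 htune hbig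
  calc sInf {a' : ℝ | EvenNegIndexAtLeast 1 a'} ≤ a + T :=
        csInf_le (bddBelow_setOf_evenNegIndexAtLeast_succ 0) hidx
    _ ≤ a + max 0 R + π / e.im + ε := by linarith

/-! ## (T6) Rigidity reading: persistence of even positivity makes the lone zero exponentially invisible -/

/-- **(T6)** If, in the lone-quadruple world, the window `[-A, A]` carries NO even negative
direction, then every even real Weil test `k` in `[-a, a]` with `a + π/γ ≤ A` satisfies
`2 m(e) |P_k(e)| (sinh(2δ(A - a - π/γ)) - 1) ≤ Re Q(k)`: the lone zero is seen by `k` only with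
strength `O(Re Q(k) e^{-2δA})`. -/
theorem lone_zero_invisible_of_not_evenNegIndexAtLeast {k : ℝ → ℂ} (hk : IsWeilTest k)
    (hev : ∀ t : ℝ, k (-t) = k t) (hre : ∀ t : ℝ, (k t).im = 0) {a : ℝ}
    (hsupp : tsupport k ⊆ Icc (-a) a) {e : ℂ} (he : e ∈ riemannZetaNontrivialZeros)
    (hδ : 1 / 2 < e.re) (hγ : 0 < e.im)
    (hlone : ∀ ρ ∈ riemannZetaNontrivialZeros,
      ρ.re ≠ 1 / 2 → ρ = e ∨ ρ = conj e ∨ ρ = 1 - e ∨ ρ = 1 - conj e)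
    {A : ℝ} (hA : ¬ EvenNegIndexAtLeast 1 A) (haA : a + π / e.im ≤ A) :
    2 * riemannZetaZeroOrder e * ‖pairCoeff k e‖ *
        (Real.sinh (2 * (e.re - 1 / 2) * (A - a - π / e.im)) - 1) ≤ (weilQuadratic k).re := by
  by_contra hlt
  rw [not_le] at hlt
  have hπγ : 0 < π / e.im := div_pos Real.pi_pos hγ
  have hQ : 0 ≤ (weilQuadratic k).re := by
    by_contra hneg
    rw [not_le] at hneg
    exact hA ((evenNegIndexAtLeast_one_of_neg hk hev hre hsupp hneg).mono (by linarith))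
  have hm : (0 : ℝ) ≤ riemannZetaZeroOrder e := by
    have : (1 : ℝ) ≤ riemannZetaZeroOrder e := by
      exact_mod_cast riemannZetaNontrivialZeros.one_le_order he
    linarith
  obtain ⟨T, ⟨hT1, hT2⟩, htune⟩ := exists_tuned (pairCoeff k e) hγ (A - a - π / e.im)
  have hT0 : 0 ≤ T := by linarith
  have hmono : Real.sinh (2 * (e.re - 1 / 2) * (A - a - π / e.im)) ≤
      Real.sinh (2 * (e.re - 1 / 2) * T) :=
    Real.sinh_le_sinh.2 (mul_le_mul_of_nonneg_left hT1 (by linarith))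
  have hbig : (weilQuadratic k).re <
      2 * riemannZetaZeroOrder e * ‖pairCoeff k e‖ * (Real.sinh (2 * (e.re - 1 / 2) * T) - 1) :=
    hlt.trans_le (mul_le_mul_of_nonneg_left (by linarith) (by positivity))
  have hidx := evenNegIndexAtLeast_one_of_lone hk hev hre hsupp he hδ hlone hT0 htune hbig
  exact hA (hidx.mono (by linarith))

/-! ## (T7) Effective Landau `Ω₋` for the zero sum `B_k` -/

/-- **(T7)** In the lone-quadruple world, at every tuned `T`:
`Re B_k(2T) ≤ Re Q(k) - 4 m(e) |P_k(e)| (sinh(2δT) - 1)`, where `B_k(y) = Σ_ρ m(ρ) P_k(ρ) e^{(ρ-½)y}`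
(`WeilConverse.expSum`): the Bochner series of the positive on-line measure is dragged below any
level by the lone off-line quadruple, at an explicit exponential rate. -/
theorem re_expSum_le_of_lone {k : ℝ → ℂ} (hk : IsWeilTest k)
    (hev : ∀ t : ℝ, k (-t) = k t) (hre : ∀ t : ℝ, (k t).im = 0) {e : ℂ}
    (he : e ∈ riemannZetaNontrivialZeros) (hδ : 1 / 2 < e.re)
    (hlone : ∀ ρ ∈ riemannZetaNontrivialZeros,
      ρ.re ≠ 1 / 2 → ρ = e ∨ ρ = conj e ∨ ρ = 1 - e ∨ ρ = 1 - conj e)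
    {T : ℝ}
    (htune : pairCoeff k e * cexp (((e.im * (2 * T) : ℝ) : ℂ) * I) = -(‖pairCoeff k e‖ : ℂ)) :
    (expSum k (2 * T)).re ≤ (weilQuadratic k).re -
      4 * riemannZetaZeroOrder e * ‖pairCoeff k e‖ * (Real.sinh (2 * (e.re - 1 / 2) * T) - 1) := by
  have h3 := re_weilQuadratic_symShift_le_of_lone hk hev hre he hδ hlone T
  have h4 := re_mul_coshSq_sub_one_le htune
  have hm : (0 : ℝ) ≤ riemannZetaZeroOrder e := by
    have : (1 : ℝ) ≤ riemannZetaZeroOrder e := by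
      exact_mod_cast riemannZetaNontrivialZeros.one_le_order he
    linarith
  have hre2 := re_weilQuadratic_symShift_eq hk T
  nlinarith [mul_le_mul_of_nonneg_left h4 hm]

/-! ## `K = 1` is the lone-quadruple world -/

/-- If the open upper quadrant `𝒬 = {ρ : ζ(ρ) = 0 non-trivial, Re ρ > 1/2, Im ρ > 0}` is the
singleton `{e}` (`K = 1`), then every off-line zero lies in the quadruple of `e`. -/
theorem lone_of_quadrant_eq_singleton {e : ℂ}
    (h𝒬 : {ρ : ℂ | ρ ∈ riemannZetaNontrivialZeros ∧ 1 / 2 < ρ.re ∧ 0 < ρ.im} = {e}) :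
    (e ∈ riemannZetaNontrivialZeros ∧ 1 / 2 < e.re ∧ 0 < e.im) ∧
      ∀ ρ ∈ riemannZetaNontrivialZeros,
        ρ.re ≠ 1 / 2 → ρ = e ∨ ρ = conj e ∨ ρ = 1 - e ∨ ρ = 1 - conj e := by
  have hmem : ∀ ρ : ℂ, (ρ ∈ riemannZetaNontrivialZeros ∧ 1 / 2 < ρ.re ∧ 0 < ρ.im) ↔ ρ = e := by
    intro ρ
    have h := Set.ext_iff.1 h𝒬 ρ
    rwa [Set.mem_setOf_eq, Set.mem_singleton_iff] at h
  refine ⟨(hmem e).2 rfl, fun ρ hρ hne ↦ ?_⟩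
  have him : ρ.im ≠ 0 := riemannZetaNontrivialZeros.im_ne_zero hρ
  rcases lt_or_gt_of_ne hne with hlt | hgt
  · rcases lt_or_gt_of_ne him with hi | hi
    · -- `Re ρ < 1/2`, `Im ρ < 0`: `1 - ρ ∈ 𝒬`
      have h1 : 1 - ρ ∈ riemannZetaNontrivialZeros := by
        simpa using
          riemannZetaNontrivialZeros.one_sub_conj_mem (riemannZetaNontrivialZeros.conj_mem hρ)
      have := (hmem (1 - ρ)).1 ⟨h1, by simp; linarith, by simp; linarith⟩
      exact Or.inr (Or.inr (Or.inl (by linear_combination -this)))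
    · -- `Re ρ < 1/2`, `Im ρ > 0`: `1 - conj ρ ∈ 𝒬`
      have := (hmem (1 - conj ρ)).1
        ⟨riemannZetaNontrivialZeros.one_sub_conj_mem hρ, by simp; linarith, by simp; linarith⟩
      have h' := congrArg conj this
      simp only [map_sub, map_one, Complex.conj_conj] at h'
      exact Or.inr (Or.inr (Or.inr (by linear_combination -h')))
  · rcases lt_or_gt_of_ne him with hi | hi
    · -- `Re ρ > 1/2`, `Im ρ < 0`: `conj ρ ∈ 𝒬`
      have := (hmem (conj ρ)).1
        ⟨riemannZetaNontrivialZeros.conj_mem hρ, by simp; linarith, by simp; linarith⟩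
      have h' := congrArg conj this
      simp only [Complex.conj_conj] at h'
      exact Or.inr (Or.inl h')
    · exact Or.inl ((hmem ρ).1 ⟨hρ, hgt, hi⟩)

/-- **Effective first even threshold when `K = 1`** (`T5'` in the quadrant language of the
`PfPersistenceM2*` files): if `𝒬 = {e}` and the even real Weil test `k` in `[-a, a]` sees `e`
(`P_k(e) = k̂(e)² ≠ 0`), then `a₁^{ev} ≤ a + max(0, arsinh(1 + Re Q(k)/(2 m |k̂(e)|²))/(2δ)) + π/γ`. -/
theorem sInf_evenNegIndexAtLeast_one_le_of_quadrant_eq_singleton {k : ℝ → ℂ} (hk : IsWeilTest k)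
    (hev : ∀ t : ℝ, k (-t) = k t) (hre : ∀ t : ℝ, (k t).im = 0) {a : ℝ}
    (hsupp : tsupport k ⊆ Icc (-a) a) {e : ℂ}
    (h𝒬 : {ρ : ℂ | ρ ∈ riemannZetaNontrivialZeros ∧ 1 / 2 < ρ.re ∧ 0 < ρ.im} = {e})
    (hP : pairCoeff k e ≠ 0) :
    sInf {a' : ℝ | EvenNegIndexAtLeast 1 a'} ≤
      a + max 0 (Real.arsinh (1 + (weilQuadratic k).re /
        (2 * riemannZetaZeroOrder e * ‖pairCoeff k e‖)) / (2 * (e.re - 1 / 2))) + π / e.im :=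
  have h := lone_of_quadrant_eq_singleton h𝒬
  sInf_evenNegIndexAtLeast_one_le_of_lone hk hev hre hsupp h.1.1 h.1.2.1 h.1.2.2 h.2 hP

end Summit.RiemannHypothesis.RiemannHypothesis.Theorems.PfPersistenceM2NegIndex
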